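import Summits.NavierStokesRegularity.FluidComputer.StrainTypeIFace
import Summits.NavierStokesRegularity.FluidComputer.LerayClock
import HarnessLib

/-!
# Fluid computer — L64-S: THE STRAIN FACE WITH AN EXPLICIT LOGARITHMIC FLOOR —
# `4 ∫_{t₀}^t m ≥ log( c ν³ / (Z(t₀)² (T − t)) )` for every continuous time-only majorant `m` of `λ₂`

HONEST FRAMING (cell `pub-fluidc`, verbatim): *low prior, high value-of-information experiment on Tao's
machine paradigm; NOT a claim that NS blows up.* Theorem side of the cell (the level dictionary); nothing here is
evidence of blow-up — necessities for EVERY maximal smooth finite-energy solution on `ℝ³`.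

L41″ says `∫_{t₀}^T sup_x λ₂⁺ dt = ∞` (no rate); L64 says `(T − t)·sup λ₂ ≥ 1/4 − o(1)` along a sequence. This file is
the TIME-INTEGRATED form with the same explicit constant, the strain twin of L65-S: the sibling cell's SHARP Miller
propagation `eWeakGradL2Sq_le_exp_two_of_midStrain_sup` (`‖∇u(t)‖² ≤ exp(2∫_{t₀}^t m)‖∇u(t₀)‖²` along an `H¹`-regular
interval, for a time-only Courant–Fischer majorant `m` of the middle strain eigenvalue) read against Leray's rate (L19).
Along every maximal smooth solution `(u, p)` of the unforced Navier–Stokes system on `ℝ³ × [0, T)` (`ν > 0`) which is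
Leray–Hopf from `u 0`, with `Z(t) = ∫|∇u(t)|²_F`:

* `gradSq_le_mul_exp_integral_of_midStrain` — for every continuous `m ≥ 0` on `(0, T)` majorising `λ₂` in two-frame form
  on `(0, T) × ℝ³` and all `0 < t₀ ≤ t < T`: `Z(t) ≤ exp(2∫_{t₀}^t m)·Z(t₀)` (restart at a good Leray–Hopf time
  `s ∈ (0, t₀)`, translate, `isH1RegularOn_Ioo`, Miller's sharp propagation, change of variables back);
* `strain_log_floor` (**L64-S**): with the absolute `c` of Leray's clock, `c ν³ ≤ Z(t₀)²·exp(4∫_{t₀}^t m)·(T − t)`;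
* `strain_log_floor_log`: **`log( cν³ / (Z(t₀)²(T − t)) ) ≤ 4∫_{t₀}^t m`** — the running integral of the maximal
  middle strain rate must grow at least like `(1/4)·log(1/(T − t))`.

Reading for the machine paradigm: the running `∫ sup_x λ₂⁺` of a run approaching a genuine singularity lies, on log axes
against `T − t`, above a line of slope `1/4`. HONEST PLACEMENT: Miller 2020 Thm 1.1 (`q = ∞`, sharp constant) × Leray's
rate; not located in print as a stated floor; `1/4` not optimal; `ν > 0`. Necessity only. 0 sorry; no definitions; no
named facts.

## References

* E. Miller, Arch. Ration. Mech. Anal. 237 (2020) 1237–1263 = arXiv:1710.05569, Thm. 1.1. [Miller2019]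
* J. Neustupa, P. Penel, in *Mathematical Fluid Mechanics*, Birkhäuser 2001, Thm. 2. [NeustupaPenel2001]
* J. C. Robinson, J. L. Rodrigo, W. Sadowski, CUP 2016, Lemma 6.11, Lemma 8.16. [RobinsonRodrigoSadowski2016]
* J. Leray, Acta Math. 63 (1934) 193–248, §20. [Leray1934]
-/

noncomputable section

open MeasureTheory Set Function Filter Topology Metric InnerProductSpace
open scoped ENNReal NNReal RealInnerProductSpace
open Literature.Analysis.FluidPDE Literature.Analysis.FunctionSpaces

namespace Summit.NavierStokesRegularity.FluidComputer.StrainLogFloor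

/-! ## Miller's sharp propagation on the class, from an arbitrary interior time -/

/-- **`∫|∇u(t)|²_F ≤ exp(2∫_{t₀}^t m)·∫|∇u(t₀)|²_F`** along a maximal smooth Leray–Hopf solution of the unforced system
(`ν > 0`), for every continuous nonnegative `m` on `(0, T)` which is a time-only Courant–Fischer majorant of the middle
strain eigenvalue on `(0, T) × ℝ³` (at each `(τ, x)` an orthonormal pair `v, w` with `⟪∇u(τ, x)ξ, ξ⟫ ≤ m(τ)|ξ|²` on
`span{v, w}`), and all `0 < t₀ ≤ t < T`. Proof: restart at a good Leray–Hopf time `s ∈ (0, t₀)`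
(`exists_isLerayHopfOn_restart_Ioo`); the translate is classical on `[0, T − s)`, Leray–Hopf from `u(s)`, `H¹`-regular on
`(0, T − s)` (`isH1RegularOn_Ioo`), with the majorant `m(· + s)` integrable on every `[0, b]`, `b < T − s` (continuity);
Miller's sharp propagation `eWeakGradL2Sq_le_exp_two_of_midStrain_sup` and the change of variables `σ ↦ σ + s`; the weak
gradient of a `C¹` slice is its gradient (`eWeakGradL2Sq_eq_of_hasWeakGradient`). [cite: Miller2019, Thm 1.1]
[cite: NeustupaPenel2001, Thm 2] -/
theorem gradSq_le_mul_exp_integral_of_midStrain {ν T : ℝ} (hν : 0 < ν) (hT : 0 < T)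
    {u : ℝ → EuclideanSpace ℝ (Fin 3) → EuclideanSpace ℝ (Fin 3)} {p : ℝ → EuclideanSpace ℝ (Fin 3) → ℝ}
    (hmax : IsMaximalSmoothSolution ν 0 u p T) (hLH : IsLerayHopfOn T ν 0 (u 0) u)
    {m : ℝ → ℝ} (hm0 : ∀ t, 0 ≤ m t) (hmc : ContinuousOn m (Ioo 0 T))
    (hmaj : ∀ t ∈ Ioo 0 T, ∀ x, ∃ v w : EuclideanSpace ℝ (Fin 3), ‖v‖ = 1 ∧ ‖w‖ = 1 ∧
      ⟪v, w⟫ = 0 ∧ ∀ α β : ℝ,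
        ⟪fderiv ℝ (u t) x (α • v + β • w), α • v + β • w⟫ ≤ m t * (α ^ 2 + β ^ 2))
    {t₀ t : ℝ} (ht₀ : 0 < t₀) (ht₀t : t₀ ≤ t) (htT : t < T) :
    (∫⁻ x, ENNReal.ofReal (frobeniusNormSq (fderiv ℝ (u t) x))).toReal ≤
      Real.exp (2 * ∫ τ in t₀..t, m τ) * (∫⁻ x, ENNReal.ofReal (frobeniusNormSq (fderiv ℝ (u t₀) x))).toReal := by
  have ht₀T : t₀ < T := ht₀t.trans_lt htT
  -- restart at a good time `s ∈ (0, t₀)` and translate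
  obtain ⟨s, hs, hLHs⟩ := hLH.exists_isLerayHopfOn_restart_Ioo hν.le le_rfl ht₀ ht₀T.le
  have hs0 : 0 < s := hs.1
  have hsT : s < T := hs.2.trans ht₀T
  have hTs : 0 < T - s := sub_pos.2 hsT
  set v : ℝ → EuclideanSpace ℝ (Fin 3) → EuclideanSpace ℝ (Fin 3) := fun τ => u (τ + s) with hv
  have hmaxs : IsMaximalSmoothSolution ν 0 v (fun τ => p (τ + s)) (T - s) := hmax.translate_zero hs0 hsT
  have hLH' : IsLerayHopfOn (T - s) ν 0 (v 0) v := by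
    show IsLerayHopfOn (T - s) ν 0 (u (0 + s)) (fun τ => u (τ + s))
    rw [zero_add]
    exact hLHs
  have hreg' : IsH1RegularOn (Ioo 0 (T - s)) v := hmaxs.isH1RegularOn_Ioo hν hTs hLH'
  obtain ⟨c', hc', hL2⟩ := tao2011_H1_local_almost_regular_holds
  -- the translated majorant
  set m' : ℝ → ℝ := fun τ => m (τ + s) with hm'
  have hm0' : ∀ τ, 0 ≤ m' τ := fun τ => hm0 _
  have hmaj' : ∀ τ ∈ Ico 0 (T - s), ∀ x, ∃ v₁ w₁ : EuclideanSpace ℝ (Fin 3), ‖v₁‖ = 1 ∧ ‖w₁‖ = 1 ∧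
      ⟪v₁, w₁⟫ = 0 ∧ ∀ α β : ℝ,
        ⟪fderiv ℝ (v τ) x (α • v₁ + β • w₁), α • v₁ + β • w₁⟫ ≤ m' τ * (α ^ 2 + β ^ 2) :=
    fun τ hτ x => hmaj (τ + s) ⟨by linarith [hτ.1], by linarith [hτ.2]⟩ x
  have hA : ∀ b < T - s, ∫⁻ τ in Ioo 0 b, ENNReal.ofReal (m' τ) ≠ ⊤ := by
    intro b hb
    rcases le_or_gt b 0 with hb0 | hb0
    · rw [Ioo_eq_empty (not_lt.2 hb0), Measure.restrict_empty, lintegral_zero_measure]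
      exact ENNReal.zero_ne_top
    · -- `m` is bounded on the compact `[s, b + s] ⊂ (0, T)`
      have hK : IsCompact (Icc s (b + s)) := isCompact_Icc
      have hmcK : ContinuousOn m (Icc s (b + s)) := hmc.mono fun τ hτ => ⟨hs0.trans_le hτ.1, by linarith [hτ.2]⟩
      obtain ⟨B, hB⟩ := hK.exists_bound_of_continuousOn hmcK
      have hle : ∫⁻ τ in Ioo 0 b, ENNReal.ofReal (m' τ) ≤ ∫⁻ _ in Ioo 0 b, ENNReal.ofReal B := by
        refine setLIntegral_mono' measurableSet_Ioo fun τ hτ => ENNReal.ofReal_le_ofReal ?_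
        have h := hB (τ + s) ⟨by linarith [hτ.1], by linarith [hτ.2]⟩
        rw [Real.norm_eq_abs] at h
        exact (le_abs_self _).trans h
      refine ne_top_of_le_ne_top ?_ hle
      rw [setLIntegral_const, Real.volume_Ioo]
      exact ENNReal.mul_ne_top ENNReal.ofReal_ne_top ENNReal.ofReal_ne_top
  -- Miller's sharp propagation on the translate, from `t₀ − s` to `t − s`
  have ht₀' : t₀ - s ∈ Ioo 0 (T - s) := ⟨by linarith [hs.2], by linarith⟩
  have ht' : t - s ∈ Ico (t₀ - s) (T - s) := ⟨by linarith, by linarith⟩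
  have hprop := eWeakGradL2Sq_le_exp_two_of_midStrain_sup hL2 hc' hν hLH' hmaxs.1 hm0' hmaj' hA le_rfl le_rfl hreg'
    ht₀' ht'
  have ev1 : v (t - s) = u t := by rw [hv]; simp only [sub_add_cancel]
  have ev0 : v (t₀ - s) = u t₀ := by rw [hv]; simp only [sub_add_cancel]
  rw [ev1, ev0] at hprop
  -- the exponent: `∫⁻_{(t₀−s, t−s)} m(σ + s) dσ = ∫_{t₀}^t m`
  have hmcI : ContinuousOn (fun σ => m (σ + s)) (Icc (t₀ - s) (t - s)) := by
    refine hmc.comp (f := fun σ => σ + s) (continuous_add_const s).continuousOn fun σ hσ => ?_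
    show σ + s ∈ Ioo 0 T
    exact ⟨by linarith [hσ.1, hs.2], by linarith [hσ.2]⟩
  have hintI : IntegrableOn (fun σ => m (σ + s)) (Ioo (t₀ - s) (t - s)) volume :=
    (hmcI.integrableOn_Icc).mono_set Ioo_subset_Icc_self
  have hJ : (∫⁻ σ in Ioo (t₀ - s) (t - s), ENNReal.ofReal (m' σ)).toReal = ∫ τ in t₀..t, m τ := by
    rw [← ofReal_integral_eq_lintegral_ofReal hintI (Eventually.of_forall fun σ => hm0 _),
      ENNReal.toReal_ofReal (setIntegral_nonneg measurableSet_Ioo fun σ _ => hm0 _),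
      ← integral_Ioc_eq_integral_Ioo, ← intervalIntegral.integral_of_le (by linarith : t₀ - s ≤ t - s),
      intervalIntegral.integral_comp_add_right (fun τ => m τ) s]
    simp only [sub_add_cancel]
  rw [hJ] at hprop
  -- back to real numbers and classical gradients
  have hregu : IsH1RegularOn (Ioo 0 T) u := hmax.isH1RegularOn_Ioo hν hT hLH
  have hEt₀ : eWeakGradL2Sq (u t₀) < ⊤ := lt_of_le_of_lt le_add_self (hregu.eH1NormSq_lt_top ⟨ht₀, ht₀T⟩)
  have hC1 : ∀ τ ∈ Ioo 0 T, ContDiff ℝ 1 (u τ) := fun τ hτ =>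
    (hmax.1.contDiff_velocity ⟨hτ.1.le, hτ.2⟩).of_le (by norm_cast)
  have hEq : ∀ τ ∈ Ioo 0 T,
      eWeakGradL2Sq (u τ) = ∫⁻ x, ENNReal.ofReal (frobeniusNormSq (fderiv ℝ (u τ) x)) := fun τ hτ =>
    eWeakGradL2Sq_eq_of_hasWeakGradient (hasWeakGradient_fderiv_of_contDiff (hC1 τ hτ))
  rw [← hEq t ⟨ht₀.trans_le ht₀t, htT⟩, ← hEq t₀ ⟨ht₀, ht₀T⟩]
  have hfin : ENNReal.ofReal (Real.exp (2 * ∫ τ in t₀..t, m τ)) * eWeakGradL2Sq (u t₀) ≠ ⊤ :=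
    ENNReal.mul_ne_top ENNReal.ofReal_ne_top hEt₀.ne
  have h := ENNReal.toReal_mono hfin hprop
  rw [ENNReal.toReal_mul, ENNReal.toReal_ofReal (Real.exp_pos _).le] at h
  exact h

/-! ## L64-S: the strain log floor -/

/-- **L64-S — THE STRAIN FACE WITH AN EXPLICIT LOGARITHMIC FLOOR.** With the absolute constant `c` of Leray's clock
(`LerayClock.enstrophy_clock_toReal`): for every `ν > 0`, `T > 0`, every maximal smooth solution `(u, p)` of the
unforced Navier–Stokes system on `ℝ³ × [0, T)` which is Leray–Hopf from `u 0`, every continuous nonnegative time-only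
Courant–Fischer majorant `m` of the middle strain eigenvalue on `(0, T) × ℝ³`, and all `0 < t₀ ≤ t < T`:
`c ν³ ≤ Z(t₀)² · exp(4∫_{t₀}^t m) · (T − t)`, `Z(t₀) = ∫|∇u(t₀)|²_F`. [cite: Miller2019, Thm 1.1]
[cite: RobinsonRodrigoSadowski2016, Lemma 6.11] [cite: Leray1934, §20] -/
theorem strain_log_floor :
    ∃ c : ℝ, 0 < c ∧ ∀ (ν T : ℝ), 0 < ν → 0 < T →
      ∀ (u : ℝ → EuclideanSpace ℝ (Fin 3) → EuclideanSpace ℝ (Fin 3)) (p : ℝ → EuclideanSpace ℝ (Fin 3) → ℝ),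
      IsMaximalSmoothSolution ν 0 u p T → IsLerayHopfOn T ν 0 (u 0) u →
      ∀ m : ℝ → ℝ, (∀ t, 0 ≤ m t) → ContinuousOn m (Ioo 0 T) →
        (∀ t ∈ Ioo 0 T, ∀ x, ∃ v w : EuclideanSpace ℝ (Fin 3), ‖v‖ = 1 ∧ ‖w‖ = 1 ∧
          ⟪v, w⟫ = 0 ∧ ∀ α β : ℝ,
            ⟪fderiv ℝ (u t) x (α • v + β • w), α • v + β • w⟫ ≤ m t * (α ^ 2 + β ^ 2)) →
        ∀ t₀ t : ℝ, 0 < t₀ → t₀ ≤ t → t < T →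
          c * ν ^ 3 ≤ (∫⁻ x, ENNReal.ofReal (frobeniusNormSq (fderiv ℝ (u t₀) x))).toReal ^ 2 *
            Real.exp (4 * ∫ τ in t₀..t, m τ) * (T - t) := by
  obtain ⟨c, hc, H⟩ := LerayClock.enstrophy_clock_toReal
  refine ⟨c, hc, fun ν T hν hT u p hmax hLH m hm0 hmc hmaj t₀ t ht₀ ht₀t htT => ?_⟩
  have h1 := H ν T hν hT u p hmax hLH t ⟨ht₀.trans_le ht₀t, htT⟩
  have h2 := gradSq_le_mul_exp_integral_of_midStrain hν hT hmax hLH hm0 hmc hmaj ht₀ ht₀t htT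
  set Zt : ℝ := (∫⁻ x, ENNReal.ofReal (frobeniusNormSq (fderiv ℝ (u t) x))).toReal with hZt
  set Z₀ : ℝ := (∫⁻ x, ENNReal.ofReal (frobeniusNormSq (fderiv ℝ (u t₀) x))).toReal with hZ₀
  set I : ℝ := ∫ τ in t₀..t, m τ with hI
  have hZt0 : 0 ≤ Zt := ENNReal.toReal_nonneg
  have h3 : Zt ^ 2 ≤ (Real.exp (2 * I) * Z₀) ^ 2 := pow_le_pow_left₀ hZt0 h2 2
  have e : (Real.exp (2 * I) * Z₀) ^ 2 = Z₀ ^ 2 * Real.exp (4 * I) := by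
    rw [mul_pow, ← Real.exp_nat_mul]; push_cast; ring_nf
  rw [e] at h3
  exact h1.trans (mul_le_mul_of_nonneg_right h3 (sub_pos.2 htT).le)

/-- **L64-S IN LOGARITHMS: `log( cν³ / (Z(t₀)²(T − t)) ) ≤ 4∫_{t₀}^t m`** with the constant `c` of `strain_log_floor`
— the running integral of any continuous nonnegative time-only majorant of the middle strain eigenvalue grows at least
like `(1/4)·log(1/(T − t))` (additive constant from `Z(t₀) = ∫|∇u(t₀)|²_F` and `ν`); in particular it diverges (L41″)
and `(T − t)·m(t) ≥ 1/4 − o(1)` along a sequence (L64). [cite: Miller2019, Thm 1.1] [cite: RobinsonRodrigoSadowski2016, Lemma 6.11] -/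
theorem strain_log_floor_log {ν T : ℝ} (hν : 0 < ν) (hT : 0 < T)
    {u : ℝ → EuclideanSpace ℝ (Fin 3) → EuclideanSpace ℝ (Fin 3)} {p : ℝ → EuclideanSpace ℝ (Fin 3) → ℝ}
    (hmax : IsMaximalSmoothSolution ν 0 u p T) (hLH : IsLerayHopfOn T ν 0 (u 0) u)
    {m : ℝ → ℝ} (hm0 : ∀ t, 0 ≤ m t) (hmc : ContinuousOn m (Ioo 0 T))
    (hmaj : ∀ t ∈ Ioo 0 T, ∀ x, ∃ v w : EuclideanSpace ℝ (Fin 3), ‖v‖ = 1 ∧ ‖w‖ = 1 ∧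
      ⟪v, w⟫ = 0 ∧ ∀ α β : ℝ,
        ⟪fderiv ℝ (u t) x (α • v + β • w), α • v + β • w⟫ ≤ m t * (α ^ 2 + β ^ 2))
    {t₀ t : ℝ} (ht₀ : 0 < t₀) (ht₀t : t₀ ≤ t) (htT : t < T) :
    Real.log (strain_log_floor.choose * ν ^ 3 /
        ((∫⁻ x, ENNReal.ofReal (frobeniusNormSq (fderiv ℝ (u t₀) x))).toReal ^ 2 * (T - t))) ≤
      4 * ∫ τ in t₀..t, m τ := by
  have hc := strain_log_floor.choose_spec.1
  have h := strain_log_floor.choose_spec.2 ν T hν hT u p hmax hLH m hm0 hmc hmaj t₀ t ht₀ ht₀t htT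
  set c : ℝ := strain_log_floor.choose with hcdef
  set Z₀ : ℝ := (∫⁻ x, ENNReal.ofReal (frobeniusNormSq (fderiv ℝ (u t₀) x))).toReal with hZ₀
  set I : ℝ := ∫ τ in t₀..t, m τ with hI
  have hcν : 0 < c * ν ^ 3 := mul_pos hc (pow_pos hν 3)
  have hZpos : 0 < Z₀ ^ 2 * (T - t) := by
    by_contra h0
    have h0' : Z₀ ^ 2 * (T - t) ≤ 0 := not_lt.1 h0
    have : c * ν ^ 3 ≤ 0 := by
      calc c * ν ^ 3 ≤ Z₀ ^ 2 * Real.exp (4 * I) * (T - t) := h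
        _ = Z₀ ^ 2 * (T - t) * Real.exp (4 * I) := by ring
        _ ≤ 0 := mul_nonpos_of_nonpos_of_nonneg h0' (Real.exp_pos _).le
    linarith
  rw [Real.log_le_iff_le_exp (div_pos hcν hZpos), div_le_iff₀ hZpos]
  calc c * ν ^ 3 ≤ Z₀ ^ 2 * Real.exp (4 * I) * (T - t) := h
    _ = Real.exp (4 * I) * (Z₀ ^ 2 * (T - t)) := by ring

end Summit.NavierStokesRegularity.FluidComputer.StrainLogFloor

end
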